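import Summits.ResolutionOfSingularities.ResolutionOfSingularities.Theorems.HilbertSamuelEliminationSigmaMaxModificationsCorridor3WLadderStrataClean
import Summits.ResolutionOfSingularities.ResolutionOfSingularities.Theorems.HilbertSamuelEliminationSigmaMaxModificationsCorridor3WLadderStrataCurveDictionary
import Literature.AlgebraicGeometry.Resolution.StrictNormalCrossingsFlatDescent
import Literature.AlgebraicGeometry.Resolution.GenericPointStalkData
import Literature.AlgebraicGeometry.Resolution.StalkSpecializesLocalization
import Literature.AlgebraicGeometry.Resolution.RegularLocalRingsProofs
import Mathlib.RingTheory.DiscreteValuationRing.TFAE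
import Mathlib.Algebra.Field.Equiv
import HarnessLib

/-!
# [OURS · L1 W4.2] ROW (K-ctr-cv), THE LOCAL CORE: a point `x′ ∈ X′` specialising from a point `ζ′` that is BIRATIONAL onto a
# DVR germ `𝒪_{X,x}/𝔭_η` downstairs carries the SAME germ — «no local ring strictly between a discrete valuation ring and its field
# of fractions» (crux chain w42, kernel (K-ctr) `StrataCentreMembersClean`, curve-germ case; hand res-D-pv-038)

OURS (cell `res-hironaka`, slot W4.2, crux `stmt-ResolutionOfSingularities-18506` / conjunct `-19249`; `--supports … --as helper`,
counted 0).  NOT a statement of the manuscript under review [claim: Hironaka2017, status: under-review] nor of [CossartJannsenSaito2020];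
AI plumbing, weaker than expert review; every `theorem` is PROVED, no definition is introduced.

## Why (the curve-germ case of (K-ctr) in the CHAIN, where no fibre hypothesis away from `x_n` is available)

At a step `f : X_{n+1} ⟶ X_n` blowing up the canonical centre `C`, let `D ∋ x_n` be the component of `V(C)` through the chain
point (a regular curve germ at `x_n`: `𝒪_{X_n,x_n}/I(D)_{x_n}` is a DVR) and `Z′ ∋ x_{n+1}` a component of `X_{n+1}(ν)` DOMINATING
`D`, with generic point `ζ′ ↦ η = η_D`.  CJS p. 104: `k(η) = k(ζ′)` (the near point over `η` is `k(η)`-rational, Thm. 3.14 at `η`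
with `e_η = 1`).  Then `𝒪_{Z′,x_{n+1}} = 𝒪_{D,x_n}`: inside the field `L = κ(ζ′)` the image `A′` of `𝒪_{X_n,x_n}` is (a copy of)
the DVR `𝒪_{X_n,x_n}/𝔭_η` whose fractions exhaust `L` (`𝒪_{X_n,η}` is the localisation of `𝒪_{X_n,x_n}` at `𝔭_η`, and
`κ(η) → κ(ζ′)` is onto), the image `B′ ⊇ A′` of `𝒪_{X_{n+1},x_{n+1}}` is (a copy of) `𝒪_{X_{n+1},x_{n+1}}/𝔭_{ζ′}` and is NOT
all of `L` (else `𝔭_{ζ′}` would be maximal, i.e. `ζ′ = x_{n+1}`); a ring between a DVR and its fraction field is one of the two,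
so `B′ = A′`.  Hence `𝒪_{X_{n+1},x_{n+1}}/I(Z′)_{x_{n+1}} ≅ 𝒪_{X_n,x_n}/I(D)_{x_n}` is regular of dimension `1`: `Z′` is a
regular curve at `x_{n+1}` (`Moving.IsRegularCurveAt`).  NO fibre hypothesis, NO properness, NO excellence is used here; the
doors (Thm. 3.14 at `η`, Thm. 3.6) enter only through `hres` in the assembly file.

## What

* `Subring.le_of_isDiscreteValuationRing_of_frac` — the sandwich: `A′ ≤ B′ < ⊤` subrings of a field, `A′` a DVR whose fractions
  exhaust the field ⇒ `B′ ≤ A′`;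
* `ker_stalkSpecializes_residue`, `exists_frac_of_residueField` — `ker (𝒪_x → κ(η)) = 𝔭_η`, and `κ(η)` consists of fractions
  `s/t`, `s, t ∈ 𝒪_x`, `t ∉ 𝔭_η`;
* `isRegularLocalRing_quotient_primeOfSpecializes_of_dominant` — THE CORE: `ζ′ ⤳ x′`, `ζ′ ≠ x′`, `κ(f ζ′) ⥲ κ(ζ′)`,
  `𝒪_{X,f x′}/𝔭_{f ζ′}` regular of dimension `1` ⇒ `𝒪_{X′,x′}/𝔭_{ζ′}` regular of dimension `1`;
* `isRegularCurveAt_of_dominant_of_isIso_residueFieldMap` — dressed for stub-4's row: `Z′` irreducible closed through the closed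
  marked point, `Z′ ≠ {x′}`, residue isomorphism at its generic point, the germ of `closure f(Z′)` at `f x′` regular of dimension
  `1` ⇒ `Moving.IsRegularCurveAt s Z′`.

[cite: CossartJannsenSaito2020, p. 104, Def. 6.34 (iii), Rem. 6.29 (1)] [cite: StacksProject, Tag 01J7] [cite: Matsumura1987, Thm. 11.2]
-/

noncomputable section

set_option linter.dupNamespace false -- mandated namespace `…ResolutionOfSingularities.ResolutionOfSingularities…` of this single-conjunct summit

open CategoryTheory AlgebraicGeometry TopologicalSpace Topology IsLocalRing
open Summit.ResolutionOfSingularities.ResolutionOfSingularities.Theorems.CampaignW42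
open Literature.AlgebraicGeometry.Resolution
open Summit.ResolutionOfSingularities.ResolutionOfSingularities.Theorems.SigmaMaxModificationsCorridor3

universe u

namespace Summit.ResolutionOfSingularities.ResolutionOfSingularities.Theorems.SigmaMaxModificationsCorridor3.Moving

/-! ## §1. Algebra: no ring strictly between a DVR and its field of fractions -/

/-- In a DVR with uniformiser `ϖ`, for non-zero `a, c`: either `c ∣ a` or `a·ϖ ∣ c`. [cite: Matsumura1987, Thm. 11.2] -/
theorem dvd_or_mul_uniformizer_dvd {A : Type*} [CommRing A] [IsDomain A] [IsDiscreteValuationRing A] {ϖ : A}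
    (hϖ : Irreducible ϖ) {a c : A} (ha : a ≠ 0) (hc : c ≠ 0) : c ∣ a ∨ a * ϖ ∣ c := by
  obtain ⟨n, u, rfl⟩ := IsDiscreteValuationRing.eq_unit_mul_pow_irreducible ha hϖ
  obtain ⟨m, v, rfl⟩ := IsDiscreteValuationRing.eq_unit_mul_pow_irreducible hc hϖ
  rcases le_or_gt m n with hmn | hnm
  · left
    obtain ⟨k, rfl⟩ := Nat.exists_eq_add_of_le hmn
    refine ⟨↑v⁻¹ * ↑u * ϖ ^ k, ?_⟩
    rw [pow_add]
    calc (↑u : A) * (ϖ ^ m * ϖ ^ k) = (↑v * ↑v⁻¹) * ↑u * (ϖ ^ m * ϖ ^ k) := by rw [Units.mul_inv, one_mul]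
      _ = ↑v * ϖ ^ m * (↑v⁻¹ * ↑u * ϖ ^ k) := by ring
  · right
    obtain ⟨k, rfl⟩ := Nat.exists_eq_add_of_lt hnm
    refine ⟨↑u⁻¹ * ↑v * ϖ ^ k, ?_⟩
    calc (↑v : A) * ϖ ^ (n + k + 1) = (↑u * ↑u⁻¹) * ↑v * ϖ ^ (n + k + 1) := by rw [Units.mul_inv, one_mul]
      _ = ↑u * ϖ ^ n * ϖ * (↑u⁻¹ * ↑v * ϖ ^ k) := by ring

/-- **No ring strictly between a DVR and its fraction field**: in a field `L`, subrings `A′ ≤ B′` with `B′ ≠ ⊤`, `A′` a DVR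
and every element of `L` a fraction of elements of `A′` ⇒ `B′ ≤ A′`. [cite: Matsumura1987, Thm. 11.2] -/
theorem Subring.le_of_isDiscreteValuationRing_of_frac {L : Type*} [Field L] {A B : Subring L} (hAB : A ≤ B) (hB : B ≠ ⊤)
    [IsDiscreteValuationRing A] (hfrac : ∀ l : L, ∃ a c : A, (c : L) ≠ 0 ∧ l * c = a) : B ≤ A := by
  obtain ⟨ϖ, hϖ⟩ := IsDiscreteValuationRing.exists_irreducible A
  have hϖ0 : (ϖ : L) ≠ 0 := fun h => hϖ.ne_zero (Subtype.ext h)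
  by_contra hBA
  obtain ⟨b, hbB, hbA⟩ := SetLike.not_le_iff_exists.mp hBA
  -- `b = a / c`
  obtain ⟨a, c, hc0, hbc⟩ := hfrac b
  have hc : c ≠ 0 := fun h => hc0 (by rw [h]; rfl)
  have ha : a ≠ 0 := by
    intro h
    rw [h] at hbc
    have hb0 : b = 0 := by simpa [hc0] using hbc
    exact hbA (hb0 ▸ A.zero_mem)
  -- `c ∤ a` (else `b ∈ A′`), so `a ϖ ∣ c` and `ϖ⁻¹ = b · e ∈ B′`
  have hϖinv : (ϖ : L)⁻¹ ∈ B := by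
    rcases dvd_or_mul_uniformizer_dvd hϖ ha hc with ⟨d, hd⟩ | ⟨e, he⟩
    · exfalso
      apply hbA
      have hb : b = (d : L) := by
        have h1 : b * (c : L) = (d : L) * (c : L) := by
          rw [hbc, hd]; push_cast; ring
        exact mul_right_cancel₀ hc0 h1
      rw [hb]; exact d.2
    · have h1 : b * ((a : L) * (ϖ : L) * (e : L)) = (a : L) := by
        calc b * ((a : L) * (ϖ : L) * (e : L)) = b * (c : L) := by rw [he]; push_cast; ring
          _ = (a : L) := hbc
      have ha0 : (a : L) ≠ 0 := fun h => ha (Subtype.ext h)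
      have h2 : (ϖ : L)⁻¹ = b * (e : L) := by
        have h3 : (b * (e : L)) * (ϖ : L) = 1 := by
          apply mul_left_cancel₀ ha0
          linear_combination h1
        exact (eq_inv_of_mul_eq_one_left h3).symm
      rw [h2]
      exact B.mul_mem hbB (hAB e.2)
  -- hence every element of `L` lies in `B′`
  apply hB
  refine eq_top_iff.mpr fun l _ => ?_
  obtain ⟨a', c', hc0', hlc⟩ := hfrac l
  have hc' : c' ≠ 0 := fun h => hc0' (by rw [h]; rfl)
  obtain ⟨m, v, hv⟩ := IsDiscreteValuationRing.eq_unit_mul_pow_irreducible hc' hϖ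
  -- `(v⁻¹ : A′) : L` is the inverse of `v`
  have hvinv : (((v⁻¹ : (↥A)ˣ) : A) : L) * ((v : A) : L) = 1 := by
    rw [← Subring.coe_mul, Units.inv_mul, Subring.coe_one]
  have hl : l = (a' : L) * (((v⁻¹ : (↥A)ˣ) : A) : L) * ((ϖ : L)⁻¹) ^ m := by
    have hcL : (c' : L) = ((v : A) : L) * (ϖ : L) ^ m := by rw [hv]; push_cast; ring
    have hv0 : ((v : A) : L) ≠ 0 := fun h => by rw [h, mul_zero] at hvinv; exact zero_ne_one hvinv
    rw [hcL] at hlc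
    have : l = (a' : L) / (((v : A) : L) * (ϖ : L) ^ m) := by
      rw [eq_div_iff (mul_ne_zero hv0 (pow_ne_zero _ hϖ0)), hlc]
    rw [this, inv_pow, div_eq_mul_inv, mul_inv, mul_assoc]
    congr 2
    exact (eq_inv_of_mul_eq_one_left hvinv).symm ▸ rfl
  rw [hl]
  exact B.mul_mem (B.mul_mem (hAB a'.2) (hAB ((v⁻¹ : (↥A)ˣ) : A).2)) (B.pow_mem hϖinv m)

/-! ## §2. Scheme plumbing: `𝒪_x → κ(η)` has kernel `𝔭_η` and `κ(η)` is its field of fractions -/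

/-- `ker (𝒪_{X,x} → 𝒪_{X,η} → κ(η)) = 𝔭_η` for `η ⤳ x`. [cite: StacksProject, Tag 01J7] -/
theorem ker_stalkSpecializes_residue {X : Scheme.{u}} {η x : X} (h : η ⤳ x) :
    RingHom.ker (X.presheaf.stalkSpecializes h ≫ X.residue η).hom = primeOfSpecializes h := by
  rw [CommRingCat.hom_comp, ← RingHom.comap_ker]
  change (RingHom.ker (IsLocalRing.residue _)).comap _ = _
  rw [IsLocalRing.ker_residue]

/-- `κ(η)` consists of fractions `s/t` of germs at `x` (`𝒪_{X,η} = (𝒪_{X,x})_{𝔭_η}`): every `r ∈ κ(η)` satisfies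
`r · t̄ = s̄` with `s, t ∈ 𝒪_{X,x}`, `t ∉ 𝔭_η`. [cite: StacksProject, Tag 01J7] -/
theorem exists_frac_of_residueField {X : Scheme.{u}} {η x : X} (h : η ⤳ x) (r : X.residueField η) :
    ∃ s t : X.presheaf.stalk x, t ∉ primeOfSpecializes h ∧
      r * (X.presheaf.stalkSpecializes h ≫ X.residue η).hom t = (X.presheaf.stalkSpecializes h ≫ X.residue η).hom s := by
  obtain ⟨q, rfl⟩ := X.residue_surjective η r
  letI := (X.presheaf.stalkSpecializes h).hom.toAlgebra
  haveI := isLocalizationAtPrime_stalkSpecializes h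
  obtain ⟨⟨s, t⟩, hst⟩ := IsLocalization.surj (primeOfSpecializes h).primeCompl q
  refine ⟨s, t, t.2, ?_⟩
  have h1 := congrArg (X.residue η).hom hst
  rw [map_mul] at h1
  simpa [RingHom.algebraMap_toAlgebra] using h1

/-! ## §3. The core: the germ upstairs IS the DVR germ downstairs -/

/-- **THE DVR-DOMINATION CORE.** `π : X′ ⟶ X` any morphism, `ζ′ ⤳ x′` in `X′` with `ζ′ ≠ x′`, `κ(π ζ′) → κ(ζ′)` an
isomorphism, and `𝒪_{X,π x′}/𝔭_{π ζ′}` a regular local ring of dimension `1` (a DVR). Then `𝒪_{X′,x′}/𝔭_{ζ′}` is a regular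
local ring of dimension `1` (indeed isomorphic to the former). [cite: CossartJannsenSaito2020, p. 104] [cite: Matsumura1987, Thm. 11.2] -/
theorem isRegularLocalRing_quotient_primeOfSpecializes_of_dominant {X X' : Scheme.{u}} (π : X' ⟶ X) {ζ' x' : X'}
    (hζ : ζ' ⤳ x') (hne : ζ' ≠ x') [IsIso (π.residueFieldMap ζ')]
    (hreg : IsRegularLocalRing (X.presheaf.stalk (π.base x') ⧸ primeOfSpecializes (π.base.hom.map_specializes hζ)))
    (hdim : ringKrullDim (X.presheaf.stalk (π.base x') ⧸ primeOfSpecializes (π.base.hom.map_specializes hζ)) = 1) :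
    IsRegularLocalRing (X'.presheaf.stalk x' ⧸ primeOfSpecializes hζ) ∧
      ringKrullDim (X'.presheaf.stalk x' ⧸ primeOfSpecializes hζ) = 1 := by
  have hη : π.base ζ' ⤳ π.base x' := π.base.hom.map_specializes hζ
  -- the two evaluation maps into `L = κ(ζ′)`
  set ψ' : X'.presheaf.stalk x' →+* X'.residueField ζ' := (X'.presheaf.stalkSpecializes hζ ≫ X'.residue ζ').hom with hψ'
  set ψ : X.presheaf.stalk (π.base x') →+* X'.residueField ζ' := ψ'.comp (π.stalkMap x').hom with hψdef
  have hψ : ψ = (π.residueFieldMap ζ').hom.comp (X.presheaf.stalkSpecializes hη ≫ X.residue (π.base ζ')).hom := by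
    rw [hψdef, hψ', ← CommRingCat.hom_comp, ← CommRingCat.hom_comp]
    congr 1
    rw [← Category.assoc, ← Scheme.Hom.stalkSpecializes_stalkMap π ζ' x' hζ, Category.assoc, ← Scheme.residue_residueFieldMap,
      Category.assoc]
  -- kernels
  have hker' : RingHom.ker ψ' = primeOfSpecializes hζ := ker_stalkSpecializes_residue hζ
  have hker : RingHom.ker ψ = primeOfSpecializes hη := by
    rw [hψ, ← RingHom.comap_ker, (RingHom.injective_iff_ker_eq_bot _).mp (π.residueFieldMap ζ').hom.injective,
      ← RingHom.ker_eq_comap_bot]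
    exact ker_stalkSpecializes_residue hη
  -- the two image subrings `A′ ≤ B′` of `L`
  set A' : Subring (X'.residueField ζ') := ψ.range with hA'
  set B' : Subring (X'.residueField ζ') := ψ'.range with hB'
  have hAB : A' ≤ B' := by
    rintro l ⟨s, rfl⟩
    exact ⟨(π.stalkMap x').hom s, rfl⟩
  let eA : (X.presheaf.stalk (π.base x') ⧸ primeOfSpecializes hη) ≃+* A' :=
    (Ideal.quotEquivOfEq hker.symm).trans (RingHom.quotientKerEquivRange ψ)
  let eB : (X'.presheaf.stalk x' ⧸ primeOfSpecializes hζ) ≃+* B' :=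
    (Ideal.quotEquivOfEq hker'.symm).trans (RingHom.quotientKerEquivRange ψ')
  -- `A′` is a DVR
  haveI hregA : IsRegularLocalRing A' := IsRegularLocalRing.of_ringEquiv eA
  have hdimA : ringKrullDim A' = 1 := by rw [← ringKrullDim_eq_of_ringEquiv eA]; exact hdim
  haveI : IsDiscreteValuationRing A' := by
    apply IsLocalRing.finrank_CotangentSpace_eq_one_iff.mp
    have h := (IsRegularLocalRing.iff_finrank_cotangentSpace A').mp hregA
    rw [hdimA] at h
    exact_mod_cast h
  -- fractions of `A′` exhaust `L`
  have hfrac : ∀ l : X'.residueField ζ', ∃ a c : A', (c : X'.residueField ζ') ≠ 0 ∧ l * c = a := by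
    intro l
    obtain ⟨r, hr⟩ := (asIso (π.residueFieldMap ζ')).commRingCatIsoToRingEquiv.surjective l
    obtain ⟨s, t, ht, hst⟩ := exists_frac_of_residueField hη r
    refine ⟨⟨ψ s, s, rfl⟩, ⟨ψ t, t, rfl⟩, ?_, ?_⟩
    · intro h0
      apply ht
      rw [← hker]
      exact h0
    · change l * ψ t = ψ s
      rw [hψ, RingHom.comp_apply, RingHom.comp_apply, ← hr]
      change (π.residueFieldMap ζ').hom r * _ = _
      rw [← map_mul, hst]
  -- `B′ ≠ ⊤`: else `𝔭_{ζ′}` is maximal, i.e. `ζ′ = x′`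
  have hB : B' ≠ ⊤ := by
    intro htop
    have e : (X'.presheaf.stalk x' ⧸ primeOfSpecializes hζ) ≃+* X'.residueField ζ' :=
      eB.trans ((RingEquiv.subringCongr htop).trans Subring.topEquiv)
    have hfield : IsField (X'.presheaf.stalk x' ⧸ primeOfSpecializes hζ) :=
      MulEquiv.isField (Field.toIsField _) e.toMulEquiv
    have hmax : primeOfSpecializes hζ = maximalIdeal _ :=
      IsLocalRing.eq_maximalIdeal (Ideal.Quotient.maximal_of_isField _ hfield)
    rw [← primeOfSpecializes_refl x'] at hmax
    have hspec : x' ⤳ ζ' := specializes_of_primeOfSpecializes_le hζ (specializes_refl x') hmax.ge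
    exact hne (hζ.antisymm hspec).eq
  -- the sandwich
  have hBA : B' = A' := le_antisymm (Subring.le_of_isDiscreteValuationRing_of_frac hAB hB hfrac) hAB
  let e : (X'.presheaf.stalk x' ⧸ primeOfSpecializes hζ) ≃+* (X.presheaf.stalk (π.base x') ⧸ primeOfSpecializes hη) :=
    (eB.trans (RingEquiv.subringCongr hBA)).trans eA.symm
  exact ⟨IsRegularLocalRing.of_ringEquiv e.symm, by rw [ringKrullDim_eq_of_ringEquiv e]; exact hdim⟩

/-! ## §4. Dressed for the row: a dominant member over a regular curve germ is a regular curve at the marked point -/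

/-- **CLAUSE 2 OF (K-ctr-cv), LOCAL FORM.** `π : s.W ⟶ X` any morphism from a marked stage with CLOSED marked point `x′`;
`Z′ ∋ x′` irreducible closed with `Z′ ≠ {x′}` and generic point `ζ′`; `κ(π ζ′) ⥲ κ(ζ′)`; and the germ at `π x′` of
`D := closure π(Z′)` regular of dimension `1` (`𝒪_{X,π x′}/I(D)_{π x′}` a DVR). Then `Z′` is a regular curve at `x′`
(`Moving.IsRegularCurveAt s Z′`). [cite: CossartJannsenSaito2020, p. 104, Rem. 6.29 (1)] -/
theorem isRegularCurveAt_of_dominant_of_isIso_residueFieldMap {X : Scheme.{u}} (s : MarkedStage.{u}) (π : s.W ⟶ X)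
    (hptc : IsClosed ({s.pt} : Set s.W)) {Z' : Set s.W} (hZ'irr : IsIrreducible Z') (hZ'c : IsClosed Z')
    (hx'Z : s.pt ∈ Z') (hne : Z' ≠ {s.pt}) {ζ' : s.W} (hζ' : IsGenericPoint ζ' Z') [IsIso (π.residueFieldMap ζ')]
    (hreg : IsRegularLocalRing (X.presheaf.stalk (π.base s.pt) ⧸
      stalkIdeal (Scheme.IdealSheafData.vanishingIdeal ⟨closure (π.base '' Z'), isClosed_closure⟩) (π.base s.pt)))
    (hdim : ringKrullDim (X.presheaf.stalk (π.base s.pt) ⧸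
      stalkIdeal (Scheme.IdealSheafData.vanishingIdeal ⟨closure (π.base '' Z'), isClosed_closure⟩) (π.base s.pt)) = 1) :
    IsRegularCurveAt s Z' := by
  haveI : IsLocallyNoetherian s.W := s.ln
  have hζ : ζ' ⤳ s.pt := hζ'.specializes hx'Z
  have hneζ : ζ' ≠ s.pt := by
    intro h
    apply hne
    rw [← hζ'.def, h, hptc.closure_eq]
  -- `closure π(Z′) = closure {π ζ′}` and `Z′ = closure {ζ′}`
  have hD : (⟨closure (π.base '' Z'), isClosed_closure⟩ : Closeds X) =
      ⟨closure {π.base ζ'}, isClosed_closure⟩ := Closeds.ext (hζ'.image π.base.hom.continuous).def.symm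
  have hZ : ∀ hc : IsClosed Z', (⟨Z', hc⟩ : Closeds s.W) = ⟨closure {ζ'}, isClosed_closure⟩ := fun hc =>
    Closeds.ext hζ'.def.symm
  rw [hD, stalkIdeal_vanishingIdeal_closure (π.base.hom.map_specializes hζ)] at hreg hdim
  obtain ⟨hreg', hdim'⟩ := isRegularLocalRing_quotient_primeOfSpecializes_of_dominant π hζ hneζ hreg hdim
  rw [← stalkIdeal_vanishingIdeal_closure hζ] at hreg' hdim'
  refine ⟨hx'Z, fun hc => by rw [hZ hc]; exact hreg', ?_⟩
  exact curve_of_ringKrullDim_quotient_le_one hZ'irr hZ'c hptc (by rw [hZ hZ'c]; exact hdim'.le)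

end Summit.ResolutionOfSingularities.ResolutionOfSingularities.Theorems.SigmaMaxModificationsCorridor3.Moving

end
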